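import Mathlib
import Summits.NavierStokesRegularity.FluidComputer.TransportGalerkinDefs
import Literature.Analysis.ODE.GalerkinLimit
import Literature.Analysis.ODE.GalerkinCompactness
import HarnessLib

/-!
# The transport Galerkin model: the set of self-consistent bounds is compact and cube-invariant; the setting from residence (instab g17, cell `ns-blowup`, 2026-08-27)

HONEST FRAMING (human ruling D-0035): nothing here is a claim about Navier–Stokes blow-up.
WHAT THIS IS NOT: not NS evidence — the STRUCTURAL half of the model instance «(β2)» of the R-β
emergence chain (`HOME/instab/BETA2-SPEC.md` §1/§3): for the objects of `TransportGalerkinDefs`,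

* §1 the cube truncations: coefficients (`coe_cubeProj` = `Lattice.trunc`), rapid decay of truncated
  families, symmetry of the cubes under `k ↦ −k`;
* §2 `cubeProj_mem_box` / `mapsTo_cubeProj_box` — the set `W = box ρ π P` is invariant under every
  cube truncation (condition S1 of [WilczakZgliczynski2025]; the three linear constraints are modewise
  or couple `k` with `−k` only); `mem_box_of_mem_iUnion`, `rapidDecay_of_mem_iUnion` — the truncated
  elements `⋃_k P_k '' W` lie in `W` and are rapidly decreasing (the reduction used by
  `GalerkinOneSidedLipschitz.galerkin_oneSided_uniform_transport_of_truncated`);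
* §3 `isClosed_box`, `isCompact_box` — `W` is compact in `E` for square-summable radii and a proper
  fibre `V` (`Literature.Analysis.ODE.isCompact_coordBox_of_summable`, WZ25 Thm. 26, cut by a closed set);
* §4 `galerkinSetting_of_residence` — the `Literature.Analysis.ODE.GalerkinConvergenceSetting` for
  `(cubeProj, nsField ν Uv π P, box ρ π P)` from: conditions (C1) `ContinuousOn` and (C2)
  `OneSidedLipschitzOnWith` (discharged in the sibling files `TransportGalerkinOneSided` /
  `TransportGalerkinContinuity`) and the RESIDENCE data (β3) — Galerkin solutions on `[0, T]` from
  `Z ⊆ W` staying in `W` (the one computer-assisted, not-owned item of BETA2-SPEC §6).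

Mathlib + the tree files cited; no new definitions.
-/

noncomputable section

namespace Summit.NavierStokesRegularity.FluidComputer.TransportGalerkinBox

open Set Filter Topology
open Literature.Analysis.FunctionSpaces Literature.Analysis.FunctionSpaces.Lattice
open Literature.Analysis.FunctionSpaces.Torus Literature.Analysis.ODE
open Summit.NavierStokesRegularity.FluidComputer.GalerkinLatticePhaseSpace
open Summit.NavierStokesRegularity.FluidComputer.TransportGalerkin
open scoped ENNReal NNReal ComplexConjugate

variable {d : Type*} [Fintype d] [DecidableEq d]
variable {V : Type*} [NormedAddCommGroup V] [NormedSpace ℂ V]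

/-! ## §1 The cube truncations on coefficient families -/

omit [Fintype d] in
/-- The cubes are symmetric under `k ↦ −k`. -/
theorem neg_mem_cube_iff [Fintype d] {n : ℕ} {k : d → ℤ} :
    -k ∈ Fintype.piFinset (fun _ : d => Finset.Icc (-(n : ℤ)) n) ↔
      k ∈ Fintype.piFinset (fun _ : d => Finset.Icc (-(n : ℤ)) n) := by
  simp only [Fintype.mem_piFinset, Finset.mem_Icc, Pi.neg_apply]
  refine forall_congr' fun i => ?_
  constructor <;> rintro ⟨h1, h2⟩ <;> exact ⟨by omega, by omega⟩

/-- Coefficients of a cube truncation: the lattice truncation `𝟙_{cube n}` of the coefficients. -/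
theorem coe_cubeProj (n : ℕ) (x : lp (fun _ : (d → ℤ) => V) 2) :
    ⇑(cubeProj n x) = trunc (Fintype.piFinset fun _ : d => Finset.Icc (-(n : ℤ)) n) ⇑x :=
  coe_lpProj_eq_trunc _ x

/-- A coefficient of a cube truncation. -/
theorem cubeProj_apply (n : ℕ) (x : lp (fun _ : (d → ℤ) => V) 2) (k : d → ℤ) :
    (cubeProj n x : (d → ℤ) → V) k =
      if k ∈ Fintype.piFinset (fun _ : d => Finset.Icc (-(n : ℤ)) n) then x k else 0 :=
  lpProj_coe_apply _ x k

/-- Truncated families are rapidly decreasing (finitely supported). -/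
theorem rapidDecay_coe_cubeProj (n : ℕ) (x : lp (fun _ : (d → ℤ) => V) 2) :
    RapidDecay (⇑(cubeProj n x)) := by
  rw [coe_cubeProj]; exact rapidDecay_trunc _ _

/-- Truncation does not increase any coefficient. -/
theorem norm_cubeProj_apply_le (n : ℕ) (x : lp (fun _ : (d → ℤ) => V) 2) (k : d → ℤ) :
    ‖(cubeProj n x : (d → ℤ) → V) k‖ ≤ ‖x k‖ := by
  rw [cubeProj_apply]
  split_ifs
  · exact le_rfl
  · rw [norm_zero]; exact norm_nonneg _

/-! ## §2 `W` is cube-invariant; truncated elements -/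

/-- **Condition S1**: a cube truncation of an element of `W = box ρ π P` lies in `W`. -/
theorem cubeProj_mem_box {ρ : (d → ℤ) → ℝ} {π : d → (V →L[ℂ] ℂ)}
    {P : (d → ℤ) → (V →L[ℂ] V)} {x : lp (fun _ : (d → ℤ) => V) 2} (hx : x ∈ box ρ π P) (n : ℕ) :
    cubeProj n x ∈ box ρ π P := by
  obtain ⟨h1, h2, h3, h4⟩ := hx
  refine ⟨fun k => (norm_cubeProj_apply_le n x k).trans (h1 k), fun k => ?_, fun j k => ?_, fun k => ?_⟩
  · rw [cubeProj_apply]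
    split_ifs
    · exact h2 k
    · exact map_zero _
  · rw [cubeProj_apply, cubeProj_apply]
    by_cases hk : k ∈ Fintype.piFinset (fun _ : d => Finset.Icc (-(n : ℤ)) n)
    · rw [if_pos (neg_mem_cube_iff.2 hk), if_pos hk]; exact h3 j k
    · rw [if_neg (fun h => hk (neg_mem_cube_iff.1 h)), if_neg hk, map_zero, map_zero]
  · rw [cubeProj_apply]
    split_ifs
    · exact h4 k
    · simp

/-- `W` is mapped to itself by every cube truncation (field `mapsTo` of the setting). -/
theorem mapsTo_cubeProj_box (ρ : (d → ℤ) → ℝ) (π : d → (V →L[ℂ] ℂ))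
    (P : (d → ℤ) → (V →L[ℂ] V)) (n : ℕ) :
    MapsTo (cubeProj n) (box ρ π P) (box ρ π P) :=
  fun _ hx => cubeProj_mem_box hx n

/-- Truncated elements of `W` lie in `W`. -/
theorem mem_box_of_mem_iUnion {ρ : (d → ℤ) → ℝ} {π : d → (V →L[ℂ] ℂ)}
    {P : (d → ℤ) → (V →L[ℂ] V)} {x : lp (fun _ : (d → ℤ) => V) 2}
    (hx : x ∈ ⋃ k : ℕ, cubeProj k '' box ρ π P) : x ∈ box ρ π P := by
  obtain ⟨k, hk⟩ := Set.mem_iUnion.1 hx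
  obtain ⟨w, hw, rfl⟩ := hk
  exact cubeProj_mem_box hw k

omit [Fintype d] in
/-- Truncated elements (of any set) are rapidly decreasing coefficient families. -/
theorem rapidDecay_of_mem_iUnion [Fintype d] {W : Set (lp (fun _ : (d → ℤ) => V) 2)}
    {x : lp (fun _ : (d → ℤ) => V) 2} (hx : x ∈ ⋃ k : ℕ, cubeProj k '' W) : RapidDecay (⇑x) := by
  obtain ⟨k, hk⟩ := Set.mem_iUnion.1 hx
  obtain ⟨w, -, rfl⟩ := hk
  exact rapidDecay_coe_cubeProj k w

/-! ## §3 `W` is closed and compact -/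

omit [Fintype d] [DecidableEq d] in
/-- Coordinate evaluation is continuous on `E`. -/
theorem continuous_apply_coe (k : d → ℤ) :
    Continuous fun x : lp (fun _ : (d → ℤ) => V) 2 => (x : (d → ℤ) → V) k :=
  (lpEval (fun _ : (d → ℤ) => V) 2 k).continuous

omit [DecidableEq d] in
/-- `W = box ρ π P` is closed: a coordinate box cut by closed linear constraints. -/
theorem isClosed_box (ρ : (d → ℤ) → ℝ) (π : d → (V →L[ℂ] ℂ)) (P : (d → ℤ) → (V →L[ℂ] V)) :
    IsClosed (box ρ π P) := by
  have hev := continuous_apply_coe (d := d) (V := V)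
  have h1 : IsClosed {x : lp (fun _ : (d → ℤ) => V) 2 | ∀ k, ‖(x : (d → ℤ) → V) k‖ ≤ ρ k} := by
    rw [Set.setOf_forall]
    exact isClosed_iInter fun k => isClosed_le (continuous_norm.comp (hev k)) continuous_const
  have h2 : IsClosed {x : lp (fun _ : (d → ℤ) => V) 2 | ∀ k, P k ((x : (d → ℤ) → V) k) = x k} := by
    rw [Set.setOf_forall]
    exact isClosed_iInter fun k => isClosed_eq ((P k).continuous.comp (hev k)) (hev k)
  have h3 : IsClosed {x : lp (fun _ : (d → ℤ) => V) 2 |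
      ∀ j k, π j ((x : (d → ℤ) → V) (-k)) = conj (π j (x k))} := by
    rw [Set.setOf_forall]
    refine isClosed_iInter fun j => ?_
    rw [Set.setOf_forall]
    exact isClosed_iInter fun k => isClosed_eq ((π j).continuous.comp (hev (-k)))
      (Complex.continuous_conj.comp ((π j).continuous.comp (hev k)))
  have h4 : IsClosed {x : lp (fun _ : (d → ℤ) => V) 2 |
      ∀ k, ∑ j, ((k j : ℤ) : ℂ) * π j ((x : (d → ℤ) → V) k) = 0} := by
    rw [Set.setOf_forall]
    refine isClosed_iInter fun k => isClosed_eq ?_ continuous_const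
    exact continuous_finsetSum _ fun j _ => continuous_const.mul ((π j).continuous.comp (hev k))
  have heq : box ρ π P = {x : lp (fun _ : (d → ℤ) => V) 2 | ∀ k, ‖(x : (d → ℤ) → V) k‖ ≤ ρ k} ∩
      ({x : lp (fun _ : (d → ℤ) => V) 2 | ∀ k, P k ((x : (d → ℤ) → V) k) = x k} ∩
      ({x : lp (fun _ : (d → ℤ) => V) 2 | ∀ j k, π j ((x : (d → ℤ) → V) (-k)) = conj (π j (x k))} ∩
       {x : lp (fun _ : (d → ℤ) => V) 2 |
          ∀ k, ∑ j, ((k j : ℤ) : ℂ) * π j ((x : (d → ℤ) → V) k) = 0})) := by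
    ext x; simp only [box, Set.mem_setOf_eq, Set.mem_inter_iff]
  rw [heq]
  exact h1.inter (h2.inter (h3.inter h4))

omit [DecidableEq d] in
/-- **`W` is compact** (field `isCompact` of the setting) for square-summable radii and a proper
fibre: the coordinate box of closed balls of radii `ρ k` is compact in `ℓ²` (WZ25 Thm. 26), and `W`
is a closed subset of it. -/
theorem isCompact_box [ProperSpace V] {ρ : (d → ℤ) → ℝ} (hρ : Summable fun k => ρ k ^ 2)
    (π : d → (V →L[ℂ] ℂ)) (P : (d → ℤ) → (V →L[ℂ] V)) : IsCompact (box ρ π P) := by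
  have h2 : (2 : ℝ≥0∞).toReal = (2 : ℕ) := by norm_num
  have hr : Summable fun k => ρ k ^ (2 : ℝ≥0∞).toReal := by
    rw [h2]; exact hρ.congr fun k => (Real.rpow_natCast (ρ k) 2).symm
  have hK : IsCompact {x : lp (fun _ : (d → ℤ) => V) 2 |
      ∀ k, (x : (d → ℤ) → V) k ∈ Metric.closedBall (0 : V) (ρ k)} :=
    isCompact_coordBox_of_summable (E := fun _ : (d → ℤ) => V) (p := 2) (by norm_num)
      (fun k => isCompact_closedBall (0 : V) (ρ k)) hr
      (fun k b hb => by rwa [Metric.mem_closedBall, dist_zero_right] at hb)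
  refine hK.of_isClosed_subset (isClosed_box ρ π P) fun x hx => ?_
  simp only [Set.mem_setOf_eq, Metric.mem_closedBall, dist_zero_right]
  exact fun k => hx.1 k

/-! ## §4 The setting from (C1), (C2) and residence -/

omit [DecidableEq d] in
/-- Square-summable radii are non-negative only where used; a radius family dominated termwise by a
summable one is square-summable (bookkeeping for the polynomial boxes `ρ k = C ⟨k⟩^{-s}`). -/
theorem summable_sq_of_summable {ρ : (d → ℤ) → ℝ} (hρ0 : ∀ k, 0 ≤ ρ k)
    (hρ : Summable fun k => sobolevWeight 1 k * ρ k) : Summable fun k => ρ k ^ 2 := by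
  -- `ρ k ≤ ∑ ⟨l⟩ρ_l =: S`, so `ρ k² ≤ S · ⟨k⟩ ρ k`
  have hle : ∀ k, ρ k ≤ sobolevWeight 1 k * ρ k := fun k =>
    le_mul_of_one_le_left (hρ0 k) (one_le_sobolevWeight zero_le_one k)
  set S := ∑' k, sobolevWeight 1 k * ρ k with hS
  have hS0 : ∀ k, ρ k ≤ S := fun k =>
    (hle k).trans (hρ.le_tsum k fun l _ => mul_nonneg (sobolevWeight_pos 1 l).le (hρ0 l))
  refine Summable.of_nonneg_of_le (fun k => sq_nonneg _) (fun k => ?_) (hρ.mul_left S)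
  calc ρ k ^ 2 = ρ k * ρ k := sq _
    _ ≤ S * (sobolevWeight 1 k * ρ k) := mul_le_mul (hS0 k) (hle k) (hρ0 k)
        ((hρ0 k).trans (hS0 k))

/-- **The Galerkin convergence setting of the transport model from (C1), (C2) and RESIDENCE.**
`E = lp (fun _ : ℤ^d => V) 2` (scaled coordinates), `P n = cubeProj n`, `F = nsField ν Uv π P`,
`W = box ρ π P` with square-summable radii `ρ`, seeds `Z ⊆ W`, window `[0, T]`. Given
condition (C1) (`F` continuous on `W`), condition (C2) (one one-sided Lipschitz constant `l` for all
truncated fields on the truncated sets) and the residence data (β3) — level-`n` Galerkin solutions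
`u n x` from every `x ∈ Z`, continuous on `[0, T]`, solving `u' = P_n F(u)` on `(0, T)`, staying in
`W` and in the range of `P_n` — this is a `Literature.Analysis.ODE.GalerkinConvergenceSetting`, to
which `GalerkinEmergenceCertificate.half_prediction_of_head_tail_certificate` /
`decay_two_of_head_tail_certificate` apply with the split `nsField_eq`. -/
theorem galerkinSetting_of_residence [ProperSpace V] {ρ : (d → ℤ) → ℝ}
    (hρ : Summable fun k => ρ k ^ 2) {ν : ℝ} {Uv : (d → ℤ) → V} {π : d → (V →L[ℂ] ℂ)}
    {P : (d → ℤ) → (V →L[ℂ] V)} {Z : Set (lp (fun _ : (d → ℤ) => V) 2)} {T l : ℝ}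
    {u : ℕ → lp (fun _ : (d → ℤ) => V) 2 → ℝ → lp (fun _ : (d → ℤ) => V) 2}
    (hT : 0 ≤ T) (hZ : Z ⊆ box ρ π P)
    (hC1 : ContinuousOn (nsField ν Uv π P) (box ρ π P))
    (hC2 : ∀ n, OneSidedLipschitzOnWith l (fun y => cubeProj n (nsField ν Uv π P y))
      (cubeProj n '' box ρ π P))
    (sol_continuousOn : ∀ n, ∀ x ∈ Z, ContinuousOn (u n x) (Icc 0 T))
    (sol_init : ∀ n, ∀ x ∈ Z, u n x 0 = cubeProj n x)
    (sol_hasDerivAt : ∀ n, ∀ x ∈ Z, ∀ t ∈ Ioo 0 T,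
      HasDerivAt (u n x) (cubeProj n (nsField ν Uv π P (u n x t))) t)
    (sol_mem : ∀ n, ∀ x ∈ Z, ∀ t ∈ Icc 0 T, u n x t ∈ box ρ π P)
    (sol_proj : ∀ n, ∀ x ∈ Z, ∀ t ∈ Icc 0 T, cubeProj n (u n x t) = u n x t) :
    GalerkinConvergenceSetting (fun n => (cubeProj n :
        lp (fun _ : (d → ℤ) => V) 2 →L[ℝ] lp (fun _ : (d → ℤ) => V) 2))
      (nsField ν Uv π P) (box ρ π P) Z T l u where
  nonneg := hT
  isCompact := isCompact_box hρ π P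
  subset := hZ
  opNorm_le := ⟨1, fun _ => opNorm_lpProj_le _⟩
  tendsto_proj := fun w => tendsto_lpProj_cube w
  proj_comp := fun _ _ hnk w => lpProj_cube_nested_le hnk w
  mapsTo := fun n => mapsTo_cubeProj_box ρ π P n
  continuousOn := hC1
  oneSided := hC2
  sol_continuousOn := sol_continuousOn
  sol_init := sol_init
  sol_hasDerivAt := sol_hasDerivAt
  sol_mem := sol_mem
  sol_proj := sol_proj

end Summit.NavierStokesRegularity.FluidComputer.TransportGalerkinBox

end
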